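import Literature.IUT.HodgeTheaters.TemperedCoveringsCor23iiiOfSpecialFibre
import Literature.IUT.HodgeTheaters.TemperedCoveringsCentreFree
import Literature.AnabelianGeometry.SemiGraphs.TemperedCompletionKernel
import Literature.AnabelianGeometry.SemiGraphs.TemperedSpecialFibreDataVertexAction
import HarnessLib

/-!
# [IUTchI] Corollary 2.3 (ii) at the GENUINE 𝔛-datum: the merge atom
# "`Ker(Δ̂_X ↠ Π̂_𝔾)` is the closure of its intersection with `Δ^tp_X`" DISCHARGED

Mochizuki, *Inter-universal Teichmüller theory I: construction of Hodge theaters*, kurims manuscript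
(May 2020), §2, Corollary 2.3 (ii) p. 47 l. 50–52 ("The closure of `Δ^tp_{X,ℍ} ⊆ Δ^tp_X ⊆ Δ̂_X` in `Δ̂_X`
is equal to `Δ̂_{X,ℍ}`"), proof p. 48 l. 13–29 ("the elementary observation … the definitions of the
various tempered fundamental groups involved") [cite: Mochizuki2012, Cor 2.3(ii) pp.47-48] (D-0012 claim
key; series status DISPUTED; nothing of the series is asserted here); the completed admissible quotient
`Δ_X ↠ Π̂_𝔾` is [SemiAnbd] Ex. 3.10 p. 45 / §6 p. 69 [cite: MochizukiSemiAnbd2006, Ex 3.10 p.45; §6 p.69].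

PROOF-ONLY sequel (no definition, no new named fact; node `IUTchI:Cor2.3(iii)`, board holder
abc-iut-w4-d058, residual `{h22, hH/hker, KER-LEVEL family, hOutTp/hOutHat}`; SUBDAG-IUTchI-Cor23 row
C23ii-L02 merge atoms) of `TemperedCoveringsCor23iiiOfSpecialFibre.lean` over abc-iut-L5-t11's bridge
`StableCurveTemperedData.ofSpecialFibre` (`StableCurveTemperedDataOfSpecialFibre.lean`).  Of the two
"density" hypotheses of abc-iut-L5-d4's `cor23ii_of_density` —

* `hker`: `Ker(ρ̂ : Δ̂_X ↠ Π̂_𝔾) ⊆` closure of `ι_Δ(Δ^tp_X) ∩ Ker ρ̂`,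
* `hH`:   `Π̂_ℍ =` closure of `Π^tp_ℍ` in `Π̂_𝔾`,

the first becomes a THEOREM at the genuine datum (`ofSpecialFibre_ker_ρHat_subset_closure`): there
`ρ̂` is the CONSTRUCTED continuous extension of the admissible quotient `Δ^temp_X ↠ π₁^temp(G^c) ↪ Π̂_𝔾`
along the profinite completion `Δ^temp_X → Δ_X`, the admissible quotient is an OPEN surjection
(`SpecialFibreData.isOpenMap_admissible`, [SemiAnbd] Ex. 3.10, PROVED in the L3 tree), and the kernel of
a completed open surjection is the closure of the image of the kernel (right exactness of profinite
completion, `IsProfiniteCompletion.ker_eq_topologicalClosure_map_ker`, `TemperedCompletionKernel.lean`):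
`OfSpecialFibre.ker_rhoHatExt_eq`.  Hence `cor23ii_ofSpecialFibre` (Cor. 2.3 (ii) AS TYPED at the genuine
datum from `hH` ALONE) and `cor23_i_to_iv_ofSpecialFibre'` (the (i)–(iv) assembly of the previous file
WITHOUT `hker`).  The second hypothesis `hH` constrains the bridge's bare PARAMETERS `Π^tp_ℍ ≤ Π^tp_𝔾`,
`Π̂_ℍ ≤ Π̂_𝔾`; it holds DEFINITIONALLY for the parameter choice `Π̂_ℍ :=` the closure of `Π^tp_ℍ` in
`Π̂_𝔾` — print's `Π̂_ℋ` (p. 44 l. 39–44: the pro-`Σ̂` fundamental group of `ℋ`, a compact group containing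
`Π^tp_ℋ` densely, regarded as a subgroup of `Π̂_𝒢`) IS that closure — whence the unconditional
`cor23ii_ofSpecialFibre_closureH`.  Model-RELATIVE (∀ `X`, `d`, `S`, parameters), as the bridge; the node
stays HELD on `{h22, hH (for general parameters), KER-LEVEL family, hOutTp/hOutHat}`; typed ≠ discharged;
nothing here bears on [IUTchIII] Cor. 3.12.
-/

noncomputable section

namespace Literature.IUT.HodgeTheaters

open _root_.Topology
open scoped Pointwise
open Literature.AnabelianGeometry.SemiGraphs

namespace StableCurveTemperedData

namespace OfSpecialFibre

variable {p : ℕ} [Fact p.Prime] (X : TemperedCurve p) (d : X.GroupLevelData)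
  (S : SpecialFibreData (X.toTemperedArithmeticGroup d))

/-- The admissible quotient read on `Δ^temp_X` is surjective. [cite: MochizukiSemiAnbd2006, Ex 3.10 p.45] -/
theorem rhoDelta_surjective : Function.Surjective (rhoDelta X d S) :=
  S.admissible_surjective.comp (MulEquiv.subgroupCongr (deltaTemp_eq_delta X d)).surjective

/-- The admissible quotient read on `Δ^temp_X` is an OPEN map (`SpecialFibreData.isOpenMap_admissible`,
transported along the identification `Δ^temp_X = Δ`). [cite: MochizukiSemiAnbd2006, Ex 3.10 p.45] -/
theorem isOpenMap_rhoDelta : IsOpenMap (rhoDelta X d S) := by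
  let e : X.DeltaTemp ≃ₜ (X.toTemperedArithmeticGroup d).delta :=
    { toEquiv := (MulEquiv.subgroupCongr (deltaTemp_eq_delta X d)).toEquiv
      continuous_toFun := continuous_induced_rng.2 continuous_subtype_val
      continuous_invFun := continuous_induced_rng.2 continuous_subtype_val }
  have h : (rhoDelta X d S : X.DeltaTemp → S.chart.G) = S.admissible ∘ e := rfl
  rw [h]
  exact S.isOpenMap_admissible.comp e.isOpenMap

variable (h36 : S.Gc.Prop36Hypotheses)

/-- **`Ker(Δ_X ↠ Π̂_𝔾)` is the closure of the image of `Ker(Δ^temp_X ↠ π₁^temp(G^c))`** — the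
"elementary observation" of the proof of Cor. 2.3 (ii) (p. 48) at the genuine datum, by right exactness
of profinite completion for the OPEN surjection `Δ^temp_X ↠ π₁^temp(G^c)`.
([IUTchI] Cor 2.3(ii) p.48) [claim: Mochizuki2012, status: disputed] -/
theorem ker_rhoHatExt_eq :
    (rhoHatExt X d S h36).toMonoidHom.ker =
      (((rhoDelta X d S).toMonoidHom.ker).map X.deltaToHat.toMonoidHom).topologicalClosure :=
  IsProfiniteCompletion.ker_eq_topologicalClosure_map_ker (X.isProfiniteCompletion_deltaToHat d)
    (iotaG_isProfiniteCompletion X d S h36) (rhoDelta X d S) (rhoDelta_surjective X d S)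
    (isOpenMap_rhoDelta X d S) (rhoHatExt X d S h36) (rhoHatExt_deltaToHat X d S h36)

end OfSpecialFibre

open OfSpecialFibre

section

variable {p : ℕ} [Fact p.Prime] (X : TemperedCurve p) (d : X.GroupLevelData)
  (S : SpecialFibreData (X.toTemperedArithmeticGroup d)) (h36 : S.Gc.Prop36Hypotheses)
  (Sigma SigmaHat : Set ℕ) (hsub : Sigma ⊆ SigmaHat) (hne : Sigma.Nonempty)
  (hprime : ∀ q ∈ SigmaHat, q.Prime) (hp : p ∉ Sigma)
  (TpH : Subgroup S.chart.G)
  (HatH : Subgroup (TemperedGraphGroupData.exists_completion_of_prop36 S.Gc h36 S.chart).choose)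
  (hle : TpH.map (TemperedGraphGroupData.exists_completion_of_prop36 S.Gc h36
    S.chart).choose_spec.choose.toMonoidHom ≤ HatH)
  (cuspMeetsH : {x : X.Pt // X.IsCusp x} → Prop)

/-- **The merge atom `hker` DISCHARGED at the genuine datum**: the kernel of the constructed
`ρ̂ : Δ̂_X ↠ Π̂_𝔾` of `ofSpecialFibre X d S …` is contained in the closure of its intersection with
`ι_Δ(Δ^tp_X)` ("the elementary observation", p. 48 l. 15–29, with "the definitions of the various tempered
fundamental groups involved"). ([IUTchI] Cor 2.3(ii) p.48) [claim: Mochizuki2012, status: disputed] -/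
theorem ofSpecialFibre_ker_ρHat_subset_closure :
    (((ofSpecialFibre X d S h36 Sigma SigmaHat hsub hne hprime hp TpH HatH hle cuspMeetsH).ρHat.ker :
        Set (ofSpecialFibre X d S h36 Sigma SigmaHat hsub hne hprime hp TpH HatH hle cuspMeetsH).DeltaHat)) ⊆
      closure
        (((ofSpecialFibre X d S h36 Sigma SigmaHat hsub hne hprime hp TpH HatH hle cuspMeetsH).ιΔ.range :
            Set (ofSpecialFibre X d S h36 Sigma SigmaHat hsub hne hprime hp TpH HatH hle cuspMeetsH).DeltaHat) ∩
          ((ofSpecialFibre X d S h36 Sigma SigmaHat hsub hne hprime hp TpH HatH hle cuspMeetsH).ρHat.ker :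
            Set (ofSpecialFibre X d S h36 Sigma SigmaHat hsub hne hprime hp TpH HatH hle cuspMeetsH).DeltaHat)) := by
  intro z hz
  -- the identification `Ker(Π_{X_K} → G_K) = Δ_X`
  let e : (augHatGK X).ker ≃* X.DeltaHat := MulEquiv.subgroupCongr (ker_augHatGK_eq_deltaHat X d)
  have he' : Continuous fun w : X.DeltaHat => (e.symm w : (augHatGK X).ker) :=
    continuous_induced_rng.2 continuous_subtype_val
  -- `ρ̂ z = 1` reads `rhoHatExt (e z) = 1`
  have hz1 : e z ∈ (rhoHatExt X d S h36).toMonoidHom.ker := hz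
  have hz2 : (e z : X.DeltaHat) ∈
      closure ((((rhoDelta X d S).toMonoidHom.ker).map X.deltaToHat.toMonoidHom :
        Subgroup X.DeltaHat) : Set X.DeltaHat) := by
    rw [← Subgroup.topologicalClosure_coe, SetLike.mem_coe, ← ker_rhoHatExt_eq X d S h36]
    exact hz1
  have hz3 : z ∈ closure ((fun w : X.DeltaHat => (e.symm w : (augHatGK X).ker)) ''
      ((((rhoDelta X d S).toMonoidHom.ker).map X.deltaToHat.toMonoidHom : Subgroup X.DeltaHat) :
        Set X.DeltaHat)) :=
    image_closure_subset_closure_image he' ⟨e z, hz2, e.symm_apply_apply z⟩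
  refine closure_mono ?_ hz3
  rintro _ ⟨_, ⟨g, hg, rfl⟩, rfl⟩
  have hg1 : rhoDelta X d S g = 1 := hg
  have hgΔ : (g : X.PiTemp) ∈ X.augGK.toMonoidHom.ker := by
    rw [ker_augGK_eq_deltaTemp]; exact g.2
  refine ⟨⟨⟨(g : X.PiTemp), hgΔ⟩, Subtype.ext rfl⟩, ?_⟩
  show rhoHatExt X d S h36 (e (e.symm (X.deltaToHat g))) = 1
  rw [MulEquiv.apply_symm_apply, rhoHatExt_deltaToHat, hg1, map_one]

/-- **[IUTchI] Cor. 2.3 (ii) AS TYPED at the genuine datum, from `hH` alone**: if the parameter `Π̂_ℍ` is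
the closure of `Π^tp_ℍ` in `Π̂_𝔾`, then the closure of `Δ^tp_{X,ℍ}` in `Δ̂_X` is `Δ̂_{X,ℍ}` — abc-iut-L5-d4's
`cor23ii_of_density` with `Π̂_𝔾` Hausdorff, `Δ̂_X` closed, `ρ̂` continuous (previous file) and `hker` (this
file) DISCHARGED. ([IUTchI] Cor 2.3(ii) p.47) [claim: Mochizuki2012, status: disputed] -/
theorem cor23ii_ofSpecialFibre
    (hH : ((ofSpecialFibre X d S h36 Sigma SigmaHat hsub hne hprime hp TpH HatH hle cuspMeetsH).graph.HatH :
        Set (ofSpecialFibre X d S h36 Sigma SigmaHat hsub hne hprime hp TpH HatH hle cuspMeetsH).graph.Hat) =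
      closure ((ofSpecialFibre X d S h36 Sigma SigmaHat hsub hne hprime hp TpH HatH hle cuspMeetsH).graph.ι ''
        (ofSpecialFibre X d S h36 Sigma SigmaHat hsub hne hprime hp TpH HatH hle cuspMeetsH).graph.TpH)) :
    (ofSpecialFibre X d S h36 Sigma SigmaHat hsub hne hprime hp TpH HatH hle cuspMeetsH).Cor23ii := by
  haveI := ofSpecialFibre_t2Space_graphHat X d S h36 Sigma SigmaHat hsub hne hprime hp TpH HatH hle cuspMeetsH
  exact (ofSpecialFibre X d S h36 Sigma SigmaHat hsub hne hprime hp TpH HatH hle cuspMeetsH).cor23ii_of_density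
    (ofSpecialFibre_isClosed_deltaHat X d S h36 Sigma SigmaHat hsub hne hprime hp TpH HatH hle cuspMeetsH)
    (ofSpecialFibre_continuous_ρHat X d S h36 Sigma SigmaHat hsub hne hprime hp TpH HatH hle cuspMeetsH)
    hH
    (ofSpecialFibre_ker_ρHat_subset_closure X d S h36 Sigma SigmaHat hsub hne hprime hp TpH HatH hle cuspMeetsH)

/-- **[IUTchI] Cor. 2.3 (i)–(iv) AS TYPED at the genuine datum, `hker` DISCHARGED**: the assembly
`cor23_i_to_iv_ofSpecialFibre` of the previous file from EXACTLY Prop. 2.2 for the special-fibre 𝔾-data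
(`h22`), `hH`, the `ℍ`-free level conclusions over a cofinal tower (`hcof`, `hA`/`hB`) and the
outer-descent atoms (`hOutTp`, `hOutHat`). ([IUTchI] Cor 2.3 pp.47-49) [claim: Mochizuki2012, status: disputed] -/
theorem cor23_i_to_iv_ofSpecialFibre'
    (h22 : (ofSpecialFibre X d S h36 Sigma SigmaHat hsub hne hprime hp TpH HatH hle
      cuspMeetsH).graph.CommensuratorsOfDecompositionSubgroups)
    (hH : ((ofSpecialFibre X d S h36 Sigma SigmaHat hsub hne hprime hp TpH HatH hle cuspMeetsH).graph.HatH :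
        Set (ofSpecialFibre X d S h36 Sigma SigmaHat hsub hne hprime hp TpH HatH hle cuspMeetsH).graph.Hat) =
      closure ((ofSpecialFibre X d S h36 Sigma SigmaHat hsub hne hprime hp TpH HatH hle cuspMeetsH).graph.ι ''
        (ofSpecialFibre X d S h36 Sigma SigmaHat hsub hne hprime hp TpH HatH hle cuspMeetsH).graph.TpH))
    (hOutTp : ∀ g : (ofSpecialFibre X d S h36 Sigma SigmaHat hsub hne hprime hp TpH HatH hle cuspMeetsH).PiTp,
      ∃ δ : (ofSpecialFibre X d S h36 Sigma SigmaHat hsub hne hprime hp TpH HatH hle cuspMeetsH).DeltaTp,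
        MulAut.conj g • ((ofSpecialFibre X d S h36 Sigma SigmaHat hsub hne hprime hp TpH HatH hle
            cuspMeetsH).deltaTpH.map
          (ofSpecialFibre X d S h36 Sigma SigmaHat hsub hne hprime hp TpH HatH hle cuspMeetsH).DeltaTp.subtype) =
        MulAut.conj (δ : (ofSpecialFibre X d S h36 Sigma SigmaHat hsub hne hprime hp TpH HatH hle
            cuspMeetsH).PiTp) •
          ((ofSpecialFibre X d S h36 Sigma SigmaHat hsub hne hprime hp TpH HatH hle cuspMeetsH).deltaTpH.map
            (ofSpecialFibre X d S h36 Sigma SigmaHat hsub hne hprime hp TpH HatH hle cuspMeetsH).DeltaTp.subtype))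
    (hOutHat : ∀ γ : (ofSpecialFibre X d S h36 Sigma SigmaHat hsub hne hprime hp TpH HatH hle cuspMeetsH).PiHat,
      ∃ δ : (ofSpecialFibre X d S h36 Sigma SigmaHat hsub hne hprime hp TpH HatH hle cuspMeetsH).DeltaHat,
        MulAut.conj γ • ((ofSpecialFibre X d S h36 Sigma SigmaHat hsub hne hprime hp TpH HatH hle
            cuspMeetsH).deltaHatH.map
          (ofSpecialFibre X d S h36 Sigma SigmaHat hsub hne hprime hp TpH HatH hle cuspMeetsH).DeltaHat.subtype) =
        MulAut.conj (δ : (ofSpecialFibre X d S h36 Sigma SigmaHat hsub hne hprime hp TpH HatH hle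
            cuspMeetsH).PiHat) •
          ((ofSpecialFibre X d S h36 Sigma SigmaHat hsub hne hprime hp TpH HatH hle cuspMeetsH).deltaHatH.map
            (ofSpecialFibre X d S h36 Sigma SigmaHat hsub hne hprime hp TpH HatH hle cuspMeetsH).DeltaHat.subtype))
    {I : Type*}
    (J : I → Subgroup (ofSpecialFibre X d S h36 Sigma SigmaHat hsub hne hprime hp TpH HatH hle cuspMeetsH).DeltaHat)
    (hcof : ∀ W : Subgroup (ofSpecialFibre X d S h36 Sigma SigmaHat hsub hne hprime hp TpH HatH hle
        cuspMeetsH).DeltaHat,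
      W.Normal → IsOpen (W : Set (ofSpecialFibre X d S h36 Sigma SigmaHat hsub hne hprime hp TpH HatH hle
        cuspMeetsH).DeltaHat) → ∃ i, J i ≤ W)
    (hA : (∃ l ∈ SigmaHat, l ∉ Sigma ∧ l ≠ p) →
      ∀ i (a : (ofSpecialFibre X d S h36 Sigma SigmaHat hsub hne hprime hp TpH HatH hle cuspMeetsH).DeltaHat),
        (∀ x ∈ J i, x ∈ (ofSpecialFibre X d S h36 Sigma SigmaHat hsub hne hprime hp TpH HatH hle
          cuspMeetsH).ρHat.ker → a * x = x * a) → a ∈ J i)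
    (hB : SigmaHat = {q | q.Prime} →
      ∀ i (a : (ofSpecialFibre X d S h36 Sigma SigmaHat hsub hne hprime hp TpH HatH hle cuspMeetsH).DeltaHat),
        (∀ x ∈ J i, x ∈ (ofSpecialFibre X d S h36 Sigma SigmaHat hsub hne hprime hp TpH HatH hle
          cuspMeetsH).ρHat.ker → a * x = x * a) → a ∈ J i) :
    (ofSpecialFibre X d S h36 Sigma SigmaHat hsub hne hprime hp TpH HatH hle cuspMeetsH).Cor23i ∧
      (ofSpecialFibre X d S h36 Sigma SigmaHat hsub hne hprime hp TpH HatH hle cuspMeetsH).Cor23ii ∧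
      (ofSpecialFibre X d S h36 Sigma SigmaHat hsub hne hprime hp TpH HatH hle cuspMeetsH).Cor23iii ∧
      (ofSpecialFibre X d S h36 Sigma SigmaHat hsub hne hprime hp TpH HatH hle cuspMeetsH).Cor23iv :=
  cor23_i_to_iv_ofSpecialFibre X d S h36 Sigma SigmaHat hsub hne hprime hp TpH HatH hle cuspMeetsH h22 hH
    (ofSpecialFibre_ker_ρHat_subset_closure X d S h36 Sigma SigmaHat hsub hne hprime hp TpH HatH hle cuspMeetsH)
    hOutTp hOutHat J hcof hA hB

end

section

variable {p : ℕ} [Fact p.Prime] (X : TemperedCurve p) (d : X.GroupLevelData)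
  (S : SpecialFibreData (X.toTemperedArithmeticGroup d)) (h36 : S.Gc.Prop36Hypotheses)
  (Sigma SigmaHat : Set ℕ) (hsub : Sigma ⊆ SigmaHat) (hne : Sigma.Nonempty)
  (hprime : ∀ q ∈ SigmaHat, q.Prime) (hp : p ∉ Sigma)
  (TpH : Subgroup S.chart.G)
  (cuspMeetsH : {x : X.Pt // X.IsCusp x} → Prop)

/-- **[IUTchI] Cor. 2.3 (ii) AS TYPED, UNCONDITIONALLY, at the genuine datum with `Π̂_ℍ :=` the closure
of `Π^tp_ℍ` in `Π̂_𝔾`** (print's `Π̂_ℋ`, p. 44 l. 39–44: the pro-`Σ̂` fundamental group of `ℋ` regarded as a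
subgroup of `Π̂_𝒢`, a compact group in which `Π^tp_ℋ` is dense — hence that closure): for this parameter
choice `hH` holds by definition and (ii) is a theorem for EVERY `Π^tp_ℍ ≤ π₁^temp(G^c)`.
([IUTchI] Cor 2.3(ii) p.47) [claim: Mochizuki2012, status: disputed] -/
theorem cor23ii_ofSpecialFibre_closureH :
    (ofSpecialFibre X d S h36 Sigma SigmaHat hsub hne hprime hp TpH
      ((TpH.map (iotaG X d S h36).toMonoidHom).topologicalClosure)
      (Subgroup.le_topologicalClosure _) cuspMeetsH).Cor23ii :=
  cor23ii_ofSpecialFibre X d S h36 Sigma SigmaHat hsub hne hprime hp TpH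
    ((TpH.map (iotaG X d S h36).toMonoidHom).topologicalClosure) (Subgroup.le_topologicalClosure _)
    cuspMeetsH (by
      show (((TpH.map (iotaG X d S h36).toMonoidHom).topologicalClosure :
          Subgroup (TemperedGraphGroupData.exists_completion_of_prop36 S.Gc h36 S.chart).choose) :
            Set (TemperedGraphGroupData.exists_completion_of_prop36 S.Gc h36 S.chart).choose) =
        closure ((iotaG X d S h36) '' (TpH : Set S.chart.G))
      rw [Subgroup.topologicalClosure_coe, Subgroup.coe_map]
      rfl)

end


/-! ### v2 (append-only): the profinite descent atom `hOutHat` FOLLOWS from `hOutTp` and (ii)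

With Cor. 2.3 (ii) a theorem at the genuine datum (from `hH`), abc-iut-w5-d023's
`StableCurveTemperedData.outerHat_of_outerTp` (`TemperedCoveringsCentreFree.lean`: tempered descent
`⇒ Π^tp_{X,ℍ} ↠ G_k ⇒` [by (ii)] `Π̂_{X,ℍ} ↠ G_k ⇔` profinite descent) removes the binder `hOutHat` as
well: the residual of the node at the genuine datum is `{h22, hH, KER-LEVEL family, hOutTp}`, where
`hOutTp` ("every `g Δ^tp_{X,ℍ} g⁻¹`, `g ∈ Π^tp_X`, is a `Δ^tp_X`-conjugate of `Δ^tp_{X,ℍ}`") is the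
group-theoretic content of print's standing hypothesis "the sub-semi-graph `ℍ ⊆ 𝔾` is stabilized by the
natural action of `G_k` on `𝔾`" (p. 47 l. 25–26) for the bare parameter `Π^tp_ℍ`. -/

section

open Literature.AlgebraicGeometry.Frobenioids (IsSlimGroup)

variable {p : ℕ} [Fact p.Prime] (X : TemperedCurve p) (d : X.GroupLevelData)
  (S : SpecialFibreData (X.toTemperedArithmeticGroup d)) (h36 : S.Gc.Prop36Hypotheses)
  (Sigma SigmaHat : Set ℕ) (hsub : Sigma ⊆ SigmaHat) (hne : Sigma.Nonempty)
  (hprime : ∀ q ∈ SigmaHat, q.Prime) (hp : p ∉ Sigma)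
  (TpH : Subgroup S.chart.G)
  (HatH : Subgroup (TemperedGraphGroupData.exists_completion_of_prop36 S.Gc h36 S.chart).choose)
  (hle : TpH.map (TemperedGraphGroupData.exists_completion_of_prop36 S.Gc h36
    S.chart).choose_spec.choose.toMonoidHom ≤ HatH)
  (cuspMeetsH : {x : X.Pt // X.IsCusp x} → Prop)

/-- **[IUTchI] Cor. 2.3 (i)–(iv) AS TYPED at the genuine datum, `hker` AND `hOutHat` DISCHARGED**: from
EXACTLY Prop. 2.2 for the special-fibre 𝔾-data (`h22`), `hH` (`Π̂_ℍ =` closure of `Π^tp_ℍ`), the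
tempered descent atom `hOutTp` ("`ℍ` is `G_k`-stable", p. 47 l. 25–26), and the `ℍ`-free level
conclusions over a cofinal tower (`hcof`, `hA`/`hB`).  The profinite descent is
`outerHat_of_outerTp (cor23ii_ofSpecialFibre … hH) hOutTp`. ([IUTchI] Cor 2.3 pp.47-49) [claim: Mochizuki2012, status: disputed] -/
theorem cor23_i_to_iv_ofSpecialFibre_of_outerTp
    (h22 : (ofSpecialFibre X d S h36 Sigma SigmaHat hsub hne hprime hp TpH HatH hle
            cuspMeetsH).graph.CommensuratorsOfDecompositionSubgroups)
    (hH : ((ofSpecialFibre X d S h36 Sigma SigmaHat hsub hne hprime hp TpH HatH hle cuspMeetsH).graph.HatH :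
        Set (ofSpecialFibre X d S h36 Sigma SigmaHat hsub hne hprime hp TpH HatH hle cuspMeetsH).graph.Hat) =
      closure ((ofSpecialFibre X d S h36 Sigma SigmaHat hsub hne hprime hp TpH HatH hle cuspMeetsH).graph.ι ''
        (ofSpecialFibre X d S h36 Sigma SigmaHat hsub hne hprime hp TpH HatH hle cuspMeetsH).graph.TpH))
    (hOutTp : ∀ g : (ofSpecialFibre X d S h36 Sigma SigmaHat hsub hne hprime hp TpH HatH hle cuspMeetsH).PiTp,
      ∃ δ : (ofSpecialFibre X d S h36 Sigma SigmaHat hsub hne hprime hp TpH HatH hle cuspMeetsH).DeltaTp,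
        MulAut.conj g • ((ofSpecialFibre X d S h36 Sigma SigmaHat hsub hne hprime hp TpH HatH hle
            cuspMeetsH).deltaTpH.map
          (ofSpecialFibre X d S h36 Sigma SigmaHat hsub hne hprime hp TpH HatH hle cuspMeetsH).DeltaTp.subtype) =
        MulAut.conj (δ : (ofSpecialFibre X d S h36 Sigma SigmaHat hsub hne hprime hp TpH HatH hle
            cuspMeetsH).PiTp) •
          ((ofSpecialFibre X d S h36 Sigma SigmaHat hsub hne hprime hp TpH HatH hle cuspMeetsH).deltaTpH.map
            (ofSpecialFibre X d S h36 Sigma SigmaHat hsub hne hprime hp TpH HatH hle cuspMeetsH).DeltaTp.subtype))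
    {I : Type*}
    (J : I → Subgroup (ofSpecialFibre X d S h36 Sigma SigmaHat hsub hne hprime hp TpH HatH hle cuspMeetsH).DeltaHat)
    (hcof : ∀ W : Subgroup (ofSpecialFibre X d S h36 Sigma SigmaHat hsub hne hprime hp TpH HatH hle
            cuspMeetsH).DeltaHat,
      W.Normal → IsOpen (W : Set (ofSpecialFibre X d S h36 Sigma SigmaHat hsub hne hprime hp TpH HatH hle
            cuspMeetsH).DeltaHat) → ∃ i, J i ≤ W)
    (hA : (∃ l ∈ SigmaHat, l ∉ Sigma ∧ l ≠ p) →
      ∀ i (a : (ofSpecialFibre X d S h36 Sigma SigmaHat hsub hne hprime hp TpH HatH hle cuspMeetsH).DeltaHat),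
        (∀ x ∈ J i, x ∈ (ofSpecialFibre X d S h36 Sigma SigmaHat hsub hne hprime hp TpH HatH hle
            cuspMeetsH).ρHat.ker → a * x = x * a) → a ∈ J i)
    (hB : SigmaHat = {q | q.Prime} →
      ∀ i (a : (ofSpecialFibre X d S h36 Sigma SigmaHat hsub hne hprime hp TpH HatH hle cuspMeetsH).DeltaHat),
        (∀ x ∈ J i, x ∈ (ofSpecialFibre X d S h36 Sigma SigmaHat hsub hne hprime hp TpH HatH hle
            cuspMeetsH).ρHat.ker → a * x = x * a) → a ∈ J i) :
    (ofSpecialFibre X d S h36 Sigma SigmaHat hsub hne hprime hp TpH HatH hle cuspMeetsH).Cor23i ∧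
      (ofSpecialFibre X d S h36 Sigma SigmaHat hsub hne hprime hp TpH HatH hle cuspMeetsH).Cor23ii ∧
      (ofSpecialFibre X d S h36 Sigma SigmaHat hsub hne hprime hp TpH HatH hle cuspMeetsH).Cor23iii ∧
      (ofSpecialFibre X d S h36 Sigma SigmaHat hsub hne hprime hp TpH HatH hle cuspMeetsH).Cor23iv :=
  cor23_i_to_iv_ofSpecialFibre' X d S h36 Sigma SigmaHat hsub hne hprime hp TpH HatH hle cuspMeetsH h22 hH
    hOutTp
    ((ofSpecialFibre X d S h36 Sigma SigmaHat hsub hne hprime hp TpH HatH hle cuspMeetsH).outerHat_of_outerTp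
      (cor23ii_ofSpecialFibre X d S h36 Sigma SigmaHat hsub hne hprime hp TpH HatH hle cuspMeetsH hH) hOutTp)
    J hcof hA hB

/-- **[IUTchI] Cor. 2.3 (iii) AS TYPED at the genuine datum, slimness BY NAME, tempered descent only**:
`cor23iii_ofSpecialFibre_of_slim` with the profinite descent atom supplied by `outerHat_of_outerTp`.
([IUTchI] Cor 2.3(iii) p.47) [claim: Mochizuki2012, status: disputed] -/
theorem cor23iii_ofSpecialFibre_of_slim_of_outerTp
    (hi : (ofSpecialFibre X d S h36 Sigma SigmaHat hsub hne hprime hp TpH HatH hle cuspMeetsH).Cor23i)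
    (hii : (ofSpecialFibre X d S h36 Sigma SigmaHat hsub hne hprime hp TpH HatH hle cuspMeetsH).Cor23ii)
    (hslim : (ofSpecialFibre X d S h36 Sigma SigmaHat hsub hne hprime hp TpH HatH hle cuspMeetsH).Cor23Hyp →
      IsSlimGroup (ofSpecialFibre X d S h36 Sigma SigmaHat hsub hne hprime hp TpH HatH hle cuspMeetsH).deltaHatH)
    (hOutTp : ∀ g : (ofSpecialFibre X d S h36 Sigma SigmaHat hsub hne hprime hp TpH HatH hle cuspMeetsH).PiTp,
      ∃ δ : (ofSpecialFibre X d S h36 Sigma SigmaHat hsub hne hprime hp TpH HatH hle cuspMeetsH).DeltaTp,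
        MulAut.conj g • ((ofSpecialFibre X d S h36 Sigma SigmaHat hsub hne hprime hp TpH HatH hle
            cuspMeetsH).deltaTpH.map
          (ofSpecialFibre X d S h36 Sigma SigmaHat hsub hne hprime hp TpH HatH hle cuspMeetsH).DeltaTp.subtype) =
        MulAut.conj (δ : (ofSpecialFibre X d S h36 Sigma SigmaHat hsub hne hprime hp TpH HatH hle
            cuspMeetsH).PiTp) •
          ((ofSpecialFibre X d S h36 Sigma SigmaHat hsub hne hprime hp TpH HatH hle cuspMeetsH).deltaTpH.map
            (ofSpecialFibre X d S h36 Sigma SigmaHat hsub hne hprime hp TpH HatH hle cuspMeetsH).DeltaTp.subtype)) :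
    (ofSpecialFibre X d S h36 Sigma SigmaHat hsub hne hprime hp TpH HatH hle cuspMeetsH).Cor23iii :=
  cor23iii_ofSpecialFibre_of_slim X d S h36 Sigma SigmaHat hsub hne hprime hp TpH HatH hle cuspMeetsH hi hii
    hslim hOutTp ((ofSpecialFibre X d S h36 Sigma SigmaHat hsub hne hprime hp TpH HatH hle cuspMeetsH).outerHat_of_outerTp hii hOutTp)

/-- **[IUTchI] Cor. 2.3 (iv) AS TYPED at the genuine datum, slimness BY NAME, tempered descent only.**
([IUTchI] Cor 2.3(iv) p.49) [claim: Mochizuki2012, status: disputed] -/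
theorem cor23iv_ofSpecialFibre_of_slim_of_outerTp
    (hi : (ofSpecialFibre X d S h36 Sigma SigmaHat hsub hne hprime hp TpH HatH hle cuspMeetsH).Cor23i)
    (hii : (ofSpecialFibre X d S h36 Sigma SigmaHat hsub hne hprime hp TpH HatH hle cuspMeetsH).Cor23ii)
    (hslim : (ofSpecialFibre X d S h36 Sigma SigmaHat hsub hne hprime hp TpH HatH hle cuspMeetsH).Cor23Hyp →
      IsSlimGroup (ofSpecialFibre X d S h36 Sigma SigmaHat hsub hne hprime hp TpH HatH hle cuspMeetsH).deltaHatH)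
    (hOutTp : ∀ g : (ofSpecialFibre X d S h36 Sigma SigmaHat hsub hne hprime hp TpH HatH hle cuspMeetsH).PiTp,
      ∃ δ : (ofSpecialFibre X d S h36 Sigma SigmaHat hsub hne hprime hp TpH HatH hle cuspMeetsH).DeltaTp,
        MulAut.conj g • ((ofSpecialFibre X d S h36 Sigma SigmaHat hsub hne hprime hp TpH HatH hle
            cuspMeetsH).deltaTpH.map
          (ofSpecialFibre X d S h36 Sigma SigmaHat hsub hne hprime hp TpH HatH hle cuspMeetsH).DeltaTp.subtype) =
        MulAut.conj (δ : (ofSpecialFibre X d S h36 Sigma SigmaHat hsub hne hprime hp TpH HatH hle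
            cuspMeetsH).PiTp) •
          ((ofSpecialFibre X d S h36 Sigma SigmaHat hsub hne hprime hp TpH HatH hle cuspMeetsH).deltaTpH.map
            (ofSpecialFibre X d S h36 Sigma SigmaHat hsub hne hprime hp TpH HatH hle cuspMeetsH).DeltaTp.subtype)) :
    (ofSpecialFibre X d S h36 Sigma SigmaHat hsub hne hprime hp TpH HatH hle cuspMeetsH).Cor23iv :=
  cor23iv_ofSpecialFibre_of_slim X d S h36 Sigma SigmaHat hsub hne hprime hp TpH HatH hle cuspMeetsH hi hii
    hslim hOutTp ((ofSpecialFibre X d S h36 Sigma SigmaHat hsub hne hprime hp TpH HatH hle cuspMeetsH).outerHat_of_outerTp hii hOutTp)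

end

end StableCurveTemperedData

end Literature.IUT.HodgeTheaters

end
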